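import Summits.Ventures.Crystal3D.Theorems.StickyWulffConstantGenericWallFloorHStarSingle
import Summits.Ventures.Crystal3D.Theorems.StickyWulffConstantGenericWallFloorExactOnlyTransport
import HarnessLib

/-!
# E1h needs ONE certified row: the six equatorial closed stars `hStar u₀` are conjugate under the vertical mirrors of the anticuboctahedron
# (crux `GenericWallFloor`, stmt-Ventures-19480, kernel G; LAYER ROWS named input `HStarModel` / lane T `stub_E1h`; cf-p1 RULINGS (ccxi)(C), (ccxiii):
#  «six ExactOnly rows, or one by symmetry once 19480-p2 lands the symmetry lemma» — this is that lemma; machine owner 19480-p2 g14, 2026-08-29)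

HONEST FRAMING. Venture `Summits/Ventures/Crystal3D` (cell `crystal3d-full`), route `route-Ventures-StickyWulffConstant`, helper for the crux
`GenericWallFloor` (stmt-Ventures-19480) / consumer `TextureLiminfV5` (stmt-Ventures-23912).  Pure symmetry bookkeeping; standard axioms; NO certificate
(the one remaining row `ExactOnly 0 (hStar (barlowPos 1 √(2/3) constHagg 0 1 0))` stays cf-p2's certified computation A12-583); F-C1 not moved.

THE POINT.  For an in-plane slot `v` the mirror `R_v` across `vᗮ` maps the h-dozen `hcpSlots` onto itself (the menu `⟪s, v⟫ ∈ {0, ±½, ±1}` and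
`add_mem_hcpSlots_of_inner`), hence maps the closed star `hStar u` onto `hStar (R_v u)`; `ExactOnly` is invariant under rigid motions
(`ExactOnly.image`).  The six in-plane slots are one orbit of these mirrors (explicit two-step chains from `u₀ = (1,0,0)`), so:
* `reflect_mem_hcpSlots`, `image_reflect_hStar` — the transport of the star;
* `exactOnly_hStar_reflect` — `ExactOnly 0 (hStar u) → ExactOnly 0 (hStar (R_v u))`;
* **`exactOnly_hStar_of_one`** — ONE in-plane row gives all six; **`hStarModel_of_exactOnly_one`** — `ExactOnly 0 (hStar (barlowPos … 0 1 0)) → HStarModel`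
  (with the hand lemma `singleDozen_hStar` of …HStarSingle).
WHAT THIS IS NOT: no proof of any `ExactOnly` row; F-C1 not moved.
-/

noncomputable section

namespace Summit.Ventures.Crystal3D.Theorems

open Finset
open Literature.MathematicalPhysics.StatisticalMechanics
open scoped InnerProductSpace

/-! ### The vertical mirrors of the anticuboctahedron -/

/-- **The mirror across an in-plane slot maps the h-dozen into itself.** -/
theorem reflect_mem_hcpSlots {v s : EuclideanSpace ℝ (Fin 3)} (hv : v ∈ fccSlots) (hv2 : v 2 = 0) (hs : s ∈ hcpSlots) :
    (ℝ ∙ v)ᗮ.reflection s ∈ hcpSlots := by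
  have hvn : ‖v‖ = 1 := norm_eq_one_of_mem_fccSlots hv
  have hnv : -v ∈ fccSlots := neg_mem_fccSlots hv
  have hnv2 : (-v) 2 = 0 := by rw [PiLp.neg_apply, hv2, neg_zero]
  rw [reflection_unit_apply hvn]
  rcases inner_hcpSlots_inPlane_mem hs hv hv2 with h | h | h | h | h
  · -- `s = v`
    have hsv : s = v := by
      have hs1 : ‖s‖ = 1 := norm_eq_one_of_mem_hcpSlots hs
      have : ‖s - v‖ ^ 2 = 0 := by
        rw [@norm_sub_sq_real, hs1, hvn, h]; ring
      rw [sq_eq_zero_iff, norm_eq_zero, sub_eq_zero] at this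
      exact this
    rw [h, hsv]
    have : v - (2 * (1 : ℝ)) • v = -v := by module
    rw [this]
    exact mem_hcpSlots_of_inPlane hnv hnv2
  · rw [h]
    have : s - (2 * (1 / 2 : ℝ)) • v = s + -v := by module
    rw [this]
    exact add_mem_hcpSlots_of_inner hs hnv hnv2 (by rw [inner_neg_right, h])
  · rw [h, mul_zero, zero_smul, sub_zero]; exact hs
  · rw [h]
    have : s - (2 * (-(1 / 2) : ℝ)) • v = s + v := by module
    rw [this]
    exact add_mem_hcpSlots_of_inner hs hv hv2 h
  · -- `s = −v`
    have hsv : s = -v := by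
      have hs1 : ‖s‖ = 1 := norm_eq_one_of_mem_hcpSlots hs
      have : ‖s + v‖ ^ 2 = 0 := by
        rw [@norm_add_sq_real, hs1, hvn, h]; ring
      rw [sq_eq_zero_iff, norm_eq_zero, add_eq_zero_iff_eq_neg] at this
      exact this
    rw [h, hsv]
    have : -v - (2 * (-1 : ℝ)) • v = v := by module
    rw [this]
    exact mem_hcpSlots_of_inPlane hv hv2

/-- **The mirror transports the closed star**: `R_v '' hStar u = hStar (R_v u)`. -/
theorem image_reflect_hStar {v : EuclideanSpace ℝ (Fin 3)} (hv : v ∈ fccSlots) (hv2 : v 2 = 0) (u : EuclideanSpace ℝ (Fin 3)) :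
    (hStar u).image (fun s => (ℝ ∙ v)ᗮ.reflection s) = hStar ((ℝ ∙ v)ᗮ.reflection u) := by
  classical
  set R := (ℝ ∙ v)ᗮ.reflection with hR
  have hRR : ∀ x, R (R x) = x := fun x => Submodule.reflection_reflection _ x
  have hinner : ∀ x y, ⟪R x, y⟫_ℝ = ⟪x, R y⟫_ℝ := fun x y => by
    rw [← LinearIsometryEquiv.inner_map_map R (R x) y, hRR]
  ext t
  simp only [hStar_eq, mem_image, mem_filter]
  constructor
  · rintro ⟨s, ⟨hs, hpos⟩, rfl⟩
    refine ⟨reflect_mem_hcpSlots hv hv2 hs, ?_⟩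
    rw [hinner, map_neg, hRR]; exact hpos
  · rintro ⟨ht, hpos⟩
    refine ⟨R t, ⟨reflect_mem_hcpSlots hv hv2 ht, ?_⟩, hRR t⟩
    rw [hinner, map_neg]; exact hpos

/-- **`ExactOnly` of a closed star passes to the mirrored star.** -/
theorem exactOnly_hStar_reflect {v : EuclideanSpace ℝ (Fin 3)} (hv : v ∈ fccSlots) (hv2 : v 2 = 0) {u : EuclideanSpace ℝ (Fin 3)}
    (h : ExactOnly 0 (hStar u)) : ExactOnly 0 (hStar ((ℝ ∙ v)ᗮ.reflection u)) := by
  classical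
  have h1 := h.image (ℝ ∙ v)ᗮ.reflection 0
  rw [map_zero, add_zero] at h1
  have himg : ((hStar u).image fun x => (ℝ ∙ v)ᗮ.reflection x + 0) = (hStar u).image fun s => (ℝ ∙ v)ᗮ.reflection s :=
    Finset.image_congr fun x _ => add_zero _
  rw [himg, image_reflect_hStar hv hv2] at h1
  exact h1

/-! ### The six in-plane slots are one orbit -/

/-- The six in-plane slots, explicitly. -/
theorem inPlane_slot_cases {u : EuclideanSpace ℝ (Fin 3)} (hu : u ∈ fccSlots) (hu2 : u 2 = 0) :
    u = barlowPos 1 (Real.sqrt (2 / 3)) constHagg 0 1 0 ∨ u = barlowPos 1 (Real.sqrt (2 / 3)) constHagg 0 0 1 ∨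
    u = barlowPos 1 (Real.sqrt (2 / 3)) constHagg 0 1 (-1) ∨ u = barlowPos 1 (Real.sqrt (2 / 3)) constHagg 0 (-1) 0 ∨
    u = barlowPos 1 (Real.sqrt (2 / 3)) constHagg 0 0 (-1) ∨ u = barlowPos 1 (Real.sqrt (2 / 3)) constHagg 0 (-1) 1 := by
  have hh : 0 < Real.sqrt (2 / 3) := Real.sqrt_pos.2 (by norm_num)
  rw [fccSlots, mem_image] at hu
  obtain ⟨c, hc, rfl⟩ := hu
  simp only [fccSlotTriples, mem_insert, mem_singleton] at hc
  rcases hc with rfl | rfl | rfl | rfl | rfl | rfl | rfl | rfl | rfl | rfl | rfl | rfl <;>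
    first
    | (exfalso; rw [barlowPos_apply_two] at hu2; push_cast at hu2; nlinarith)
    | simp

/-- Inner products of in-plane sites: `⟪(i,j), (i',j')⟫ = i i' + (i j' + j i')/2 + j j'`. -/
theorem inner_inPlane_sites (i j i' j' : ℤ) :
    ⟪barlowPos 1 (Real.sqrt (2 / 3)) constHagg 0 i j, barlowPos 1 (Real.sqrt (2 / 3)) constHagg 0 i' j'⟫_ℝ =
      i * i' + (i * j' + j * i') / 2 + j * j' := by
  rw [EuclideanSpace.inner_eq_star_dotProduct]
  simp [Fin.sum_univ_three, dotProduct]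
  have h3 : Real.sqrt 3 * Real.sqrt 3 = 3 := Real.mul_self_sqrt (by norm_num)
  linear_combination (1 / 4 * (j : ℝ) * j') * h3

/-- **Two in-plane slots are never orthogonal** (the hexagon has no right angle). -/
private theorem inner_basal_slots_ne_zero {a b : EuclideanSpace ℝ (Fin 3)} (ha : a ∈ fccSlots) (ha2 : a 2 = 0) (hb : b ∈ fccSlots) (hb2 : b 2 = 0) :
    ⟪a, b⟫_ℝ ≠ 0 := by
  rcases inPlane_slot_cases ha ha2 with rfl | rfl | rfl | rfl | rfl | rfl <;>
    rcases inPlane_slot_cases hb hb2 with rfl | rfl | rfl | rfl | rfl | rfl <;>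
      · rw [inner_inPlane_sites]; push_cast; norm_num

/-- A mirror step between explicit in-plane slots: if `⟪u, v⟫ = ½` then `R_v u = u − v`; if `u = v` then `R_v u = −u`. -/
theorem reflection_slot_of_inner_half {u v : EuclideanSpace ℝ (Fin 3)} (hv : ‖v‖ = 1) (h : ⟪u, v⟫_ℝ = 1 / 2) :
    (ℝ ∙ v)ᗮ.reflection u = u - v := by
  rw [reflection_unit_apply hv, h]; module

/-- The mirror across `v` sends `v` to `−v`. -/
theorem reflection_slot_self {v : EuclideanSpace ℝ (Fin 3)} (hv : ‖v‖ = 1) : (ℝ ∙ v)ᗮ.reflection v = -v := by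
  rw [reflection_unit_apply hv, real_inner_self_eq_norm_sq, hv]; module

/-- **ONE ROW GIVES ALL SIX.**  If the closed star of ONE in-plane slot is exact-only, so are the closed stars of all six in-plane slots. -/
theorem exactOnly_hStar_of_one {u₀ : EuclideanSpace ℝ (Fin 3)} (hu₀ : u₀ ∈ fccSlots) (hu₀2 : u₀ 2 = 0) (h : ExactOnly 0 (hStar u₀)) :
    ∀ u ∈ fccSlots, u 2 = 0 → ExactOnly 0 (hStar u) := by
  intro u hu hu2
  have hu₀n : ‖u₀‖ = 1 := norm_eq_one_of_mem_fccSlots hu₀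
  have hun : ‖u‖ = 1 := norm_eq_one_of_mem_fccSlots hu
  -- `−u₀` is exact-only too (mirror across `u₀` itself)
  have hneg : ExactOnly 0 (hStar (-u₀)) := by
    have := exactOnly_hStar_reflect hu₀ hu₀2 h
    rwa [reflection_slot_self hu₀n] at this
  have hnu₀ : -u₀ ∈ fccSlots := neg_mem_fccSlots hu₀
  have hnu₀2 : (-u₀) 2 = 0 := by rw [PiLp.neg_apply, hu₀2, neg_zero]
  -- one mirror step from `w` with `⟪w, u⟫ = ½`... we go from `u₀` or `−u₀` to `u` according to the sign of `⟪u₀, u⟫`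
  have step : ∀ {w : EuclideanSpace ℝ (Fin 3)}, w ∈ fccSlots → w 2 = 0 → ExactOnly 0 (hStar w) → ⟪w, u⟫_ℝ = 1 / 2 → ExactOnly 0 (hStar u) := by
    intro w hw hw2 hE hwu
    -- mirror across the in-plane slot `w − u`
    have hvs : w - u ∈ fccSlots := sub_mem_fccSlots_of_inner_eq_half hw hu hwu
    have hv2 : (w - u) 2 = 0 := by rw [PiLp.sub_apply, hw2, hu2, sub_zero]
    have hvn : ‖w - u‖ = 1 := norm_eq_one_of_mem_fccSlots hvs
    have hwv : ⟪w, w - u⟫_ℝ = 1 / 2 := by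
      rw [inner_sub_right, real_inner_self_eq_norm_sq, norm_eq_one_of_mem_fccSlots hw, hwu]; norm_num
    have := exactOnly_hStar_reflect hvs hv2 hE
    rwa [reflection_slot_of_inner_half hvn hwv, sub_sub_cancel] at this
  rcases inner_slots_mem hu₀ hu with h1 | h1 | h1 | h1 | h1
  · -- `u = u₀`
    have : u = u₀ := by
      have : ‖u₀ - u‖ ^ 2 = 0 := by rw [@norm_sub_sq_real, hu₀n, hun, h1]; ring
      rw [sq_eq_zero_iff, norm_eq_zero, sub_eq_zero] at this
      exact this.symm
    rw [this]; exact h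
  · exact step hu₀ hu₀2 h h1
  · -- two in-plane slots are never orthogonal
    exact absurd h1 (inner_basal_slots_ne_zero hu₀ hu₀2 hu hu2)
  · -- `⟪u₀, u⟫ = −½`: go through `−u₀`
    exact step hnu₀ hnu₀2 hneg (by rw [inner_neg_left, h1, neg_neg])
  · -- `u = −u₀`
    have : u = -u₀ := by
      have : ‖u₀ + u‖ ^ 2 = 0 := by rw [@norm_add_sq_real, hu₀n, hun, h1]; ring
      rw [sq_eq_zero_iff, norm_eq_zero, add_comm, add_eq_zero_iff_eq_neg] at this
      exact this
    rw [this]; exact hneg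

/-- **E1h FROM ONE ROW**: the single certified row `ExactOnly 0 (hStar (1,0,0))` (orbit A12-583 of the model anticuboctahedron) gives `HStarModel`. -/
theorem hStarModel_of_exactOnly_one (h : ExactOnly 0 (hStar (barlowPos 1 (Real.sqrt (2 / 3)) constHagg 0 1 0))) : HStarModel := by
  have hu₀ : barlowPos 1 (Real.sqrt (2 / 3)) constHagg 0 1 0 ∈ fccSlots := by
    rw [fccSlots, mem_image]; exact ⟨(0, 1, 0), by simp [fccSlotTriples], rfl⟩
  have hu₀2 : (barlowPos 1 (Real.sqrt (2 / 3)) constHagg 0 1 0) 2 = 0 := by rw [barlowPos_apply_two]; simp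
  exact hStarModel_of_exactOnly (exactOnly_hStar_of_one hu₀ hu₀2 h)

end Summit.Ventures.Crystal3D.Theorems

end
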